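import Summits.HodgeConjecture.HodgeConjecture.Theses.EndoscopicMiddleDegree
import Literature.AlgebraicGeometry.HodgeTheory.HodgeClassesCupPairingOfHodgeRiemann
import Literature.AlgebraicGeometry.HodgeTheory.SupportedClassesRationalProofs
import Literature.AlgebraicGeometry.HodgeTheory.SupportedClassesHodgeConiveau
import Literature.AlgebraicGeometry.HodgeTheory.HodgeFiltrationModelsReductionProofs
import Literature.AlgebraicGeometry.HodgeTheory.VanishingCohomologyNontrivialProofs
import Literature.AlgebraicGeometry.HodgeTheory.HolomorphicBundleChernCharacterTopDegree
import Literature.AlgebraicGeometry.HodgeTheory.CupPreservesHodgeTypeOfDeRham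

/-!
# Route EndoscopicMiddleDegree · `OrthogonalSplit` (stmt-HodgeConjecture-14299) — the orthogonal split
of the middle-degree Hodge classes along the theta world

For a datum `D : UnitaryBallQuotientDatum (2(m+1)) X` and the THETA WORLD
`TW(D) = SC^{m+1}(D) ⊔ SCon(D) ⊔ span{a ∪ d : a ∈ Hdg^{m,m}_ℚ, d ∈ N¹H²} ⊆ H^{2(m+1)}(X(ℂ); ℂ)`, every
rational Hodge `(m+1,m+1)`-class lies in `TW(D) + span_ℂ {e rational Hodge (m+1,m+1) : e ∪ TW(D) = 0}`.
PROOF (Voisin I §6.2.3, §6.3.2, §7.1.2; BFNP 2009 §6 (6.1)) for an ARBITRARY subspace `T` with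
(T1) `T ⊆ span_ℂ` of its own rational Hodge `(n,n)`-classes (`n = m + 1`) and (T2) `b ∪ d ∈ T` for all
rational Hodge `(m,m)`-classes `b` and divisor classes `d`: (1) `hodgeClass_eq_zero_of_cup_orthogonal` — a
rational Hodge `(n,n)`-class `t` with `t ∪ (b ∪ d) = 0` for all such `b, d` and `t ∪ t = 0` vanishes
(`t = p + L a` by the Lefschetz step; `a ∪ L² b = 0` for all `b ∈ Hdg^{m,m}_ℚ` forces `a = 0` by the
perfect pairing (6.1) and hard Lefschetz over `ℚ`; then `p ∪ p = 0` forces `p = 0` by Hodge–Riemann);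
(2) `exists_sub_sum_cup_eq_zero` (linear algebra over `ℚ`) and `exists_eq_ratCast_smul_of_isRationalClass`
(rational classes of the line `H^{4n}(X(ℂ); ℂ)` are rational multiples of one of them);
(3) `mem_sup_span_orthogonal` — a finite `ℂ`-basis of `T` among its rational Hodge classes, non-isotropy
from (1) via (T2), split `c = Σ qᵢ tᵢ + e`; (4) `orthogonalSplit_of_kaehlerPackage` — `TW(D)` has (T1)
(supported classes are spanned by RATIONAL supported classes, `ker_restrictCompl_le_span`, of type
`(codim, codim)` by Grothendieck's coniveau inclusion; `(m,m) ∪ (1,1) = (m+1,m+1)` by de Rham's theorem in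
multiplicative form) and (T2) as its third summand.
CONDITIONAL (gate: `conditional-result`) on three named facts: `Grothendieck1969_supportedClasses_le_hodgeConiveau`,
`exists_deRhamIsoFamily` (Warner 5.36/5.45) and the Kähler package `hardLefschetz_hodgeRiemann` (Voisin I
Thm. 6.25 + 6.32 for the hyperplane class; stated below, cited, for relocation to `Literature/`).
-/

noncomputable section

-- `Summit.HodgeConjecture.HodgeConjecture.Theorems` is the mandated namespace (single-problem summit:
-- Problem = Summit), which `linter.dupNamespace` flags on every declaration; the lakefile turns the
-- linter off tree-wide (weak option), restated here so stand-alone elaboration is warning-free too.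
set_option linter.dupNamespace false

open Literature.AlgebraicGeometry.Motives Literature.AlgebraicGeometry.HodgeTheory
open Literature.AlgebraicGeometry.ShimuraVarieties Literature.AlgebraicTopology.SingularHomology
open Literature.Geometry.Kaehler
open scoped Manifold

namespace Summit.HodgeConjecture.HodgeConjecture.Theorems

/-- **Hard Lefschetz with the Hodge–Riemann bilinear relations for the hyperplane class** (named fact).
For `X` smooth projective of dimension `d` over `ℂ` there is a hard Lefschetz datum
`Λ : HardLefschetzNFold d X` (intended: `[H] = c₁(𝒪_X(1))`, the integral Kähler class of the restricted
Fubini–Study metric, Voisin I Thm. 7.10; hard Lefschetz Thm. 6.25, Rem. 6.27, §7.1.2) whose class has the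
HODGE–RIEMANN ANISOTROPY on rational primitive `(m,m)`-classes: for `2m + s = d` and `y ∈ H^{2m}(X(ℂ); ℂ)`
rational of type `(m,m)` with `L^{s+1} y = 0`, `y ≠ 0`: `Lˢ y ∪ y ≠ 0 ∈ H^{2d}(X(ℂ); ℂ)` — Thm. 6.32 ("the
form `(-1)^{k(k-1)/2} i^{p-q-k} H_k` is positive definite on `H^{p,q}_prim`") at `k = 2m`, `p = q = m`,
`α = β = y` real: `(-1)ᵐ ∫ L^{d-2m} y ∪ y > 0`, rendered SIGN-FREE (no orientation `H^{2d}(X(ℂ); ℂ) ≅ ℂ` is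
fixed), weaker than print. Both clauses concern the SAME class, whence the bundling (= hypothesis (ii) of
`hodgeClasses_cupPairing_nondegenerate_of_hardLefschetz_hodgeRiemann`; refines `nonempty_hardLefschetzNFold`,
`hodgeIndex_primitiveAlgebraic`). One `Prop` per `(d, X)`.
[cite: VoisinHodgeI2002, Thm. 6.25, Rem. 6.27, Thm. 6.32, §7.1.2 and Thm. 7.10]
[file AlgebraicGeometry/HodgeTheory/HardLefschetzHodgeRiemann] -/
def hardLefschetz_hodgeRiemann (d : ℕ) (X : SchemeOver ℂ) : Prop :=
  IsSmoothProjective d X → ∃ Λ : HardLefschetzNFold d X,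
    ∀ (m s : ℕ) (_ : 2 * m + s = d) (y : complexBetti X (2 * m)), IsRationalClass y →
      IsOfHodgeType d X (2 * m) m m y →
      Λ.L (s + 1) (2 * m) (2 * m + 2 * (s + 1)) rfl y = 0 → y ≠ 0 →
      cupProduct (show 2 * m + 2 * s + 2 * m = 2 * d by omega)
        (Λ.L s (2 * m) (2 * m + 2 * s) rfl y) y ≠ 0

/-- **Linear algebra over `ℚ`.** For a `ℂ`-bilinear `B`, a finite family `t` whose Gram values
`B (t i) (t j) = g i j • ρ` and test values `B c (t j) = γ j • ρ` have RATIONAL coefficients, and no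
non-trivial rational combination of the `t i` `B`-orthogonal to all `t j`: some rational combination
`Σ qᵢ tᵢ` has `B (c - Σ qᵢ tᵢ) (t j) = 0` for all `j` (`q ↦ q ᵥ* g` is injective, hence onto). -/
theorem exists_sub_sum_cup_eq_zero {V W : Type*} [AddCommGroup V] [Module ℂ V] [AddCommGroup W]
    [Module ℂ W] (B : V →ₗ[ℂ] V →ₗ[ℂ] W) {ι : Type*} [Fintype ι] (t : ι → V) (c : V) {ρ : W}
    (g : ι → ι → ℚ) (hg : ∀ i j, B (t i) (t j) = ((g i j : ℚ) : ℂ) • ρ) (γ : ι → ℚ)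
    (hγ : ∀ j, B c (t j) = ((γ j : ℚ) : ℂ) • ρ)
    (hN : ∀ q : ι → ℚ, (∀ j, B (∑ i, ((q i : ℚ) : ℂ) • t i) (t j) = 0) → q = 0) :
    ∃ q : ι → ℚ, ∀ j, B (c - ∑ i, ((q i : ℚ) : ℂ) • t i) (t j) = 0 := by
  have key : ∀ (q : ι → ℚ) (j : ι),
      B (∑ i, ((q i : ℚ) : ℂ) • t i) (t j) = ((Matrix.vecMul q g j : ℚ) : ℂ) • ρ := by
    intro q j
    simp only [map_sum, map_smul, LinearMap.sum_apply, LinearMap.smul_apply, hg, smul_smul,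
      ← Finset.sum_smul, Matrix.vecMul, dotProduct, Rat.cast_sum, Rat.cast_mul]
  have hinj : Function.Injective (Matrix.vecMulLinear g) := by
    intro q q' hqq'
    rw [← sub_eq_zero]
    refine hN (q - q') fun j ↦ ?_
    rw [key]
    have : Matrix.vecMul (q - q') g j = 0 := by
      have h := congrFun hqq' j
      simp only [Matrix.vecMulLinear_apply] at h
      rw [Matrix.sub_vecMul, Pi.sub_apply, h, sub_self]
    rw [this, Rat.cast_zero, zero_smul]
  obtain ⟨q, hq⟩ := (LinearMap.injective_iff_surjective.1 hinj) γ
  refine ⟨q, fun j ↦ ?_⟩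
  rw [map_sub, LinearMap.sub_apply, key, hγ, ← sub_smul, ← Rat.cast_sub]
  have : γ j - Matrix.vecMul q g j = 0 := by
    have h := congrFun hq j
    simp only [Matrix.vecMulLinear_apply] at h
    rw [h, sub_self]
  rw [this, Rat.cast_zero, zero_smul]

variable {m : ℕ} {X : SchemeOver ℂ}

/-- On a one-dimensional `Hᵏ(X(ℂ); ℂ)` spanned by a non-zero rational class `ρ`, every rational class
is a RATIONAL multiple of `ρ` (two rational classes on a line satisfy a rational relation:
`ℚ`-independence of rational classes is `ℂ`-independence, `linearIndependent_iff_of_isRationalClass`). -/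
theorem exists_eq_ratCast_smul_of_isRationalClass {k : ℕ}
    (hk : Module.finrank ℂ (complexBetti X k) = 1) {ρ : complexBetti X k} (hρ : IsRationalClass ρ)
    (hρ0 : ρ ≠ 0) {w : complexBetti X k} (hw : IsRationalClass w) :
    ∃ q : ℚ, w = ((q : ℚ) : ℂ) • ρ := by
  haveI : Module.Finite ℂ (complexBetti X k) := Module.finite_of_finrank_eq_succ hk
  set b : Fin 2 → complexBetti X k := ![ρ, w] with hb
  have hbQ : ∀ j, IsRationalClass (b j) := fun j ↦ by fin_cases j <;> assumption
  have hnot : ¬ LinearIndependent ℂ b := fun h ↦ by simpa [hk] using h.fintype_card_le_finrank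
  rw [linearIndependent_iff_of_isRationalClass hbQ] at hnot
  push Not at hnot
  obtain ⟨q, hq, hq0⟩ := hnot
  rw [Fin.sum_univ_two] at hq
  simp only [hb, Matrix.cons_val_zero, Matrix.cons_val_one] at hq
  by_cases h1 : q 1 = 0
  · exfalso
    rw [h1, Rat.cast_zero, zero_smul, add_zero] at hq
    have h0 : ((q 0 : ℚ) : ℂ) = 0 := by
      by_contra h0
      exact hρ0 ((smul_eq_zero.1 hq).resolve_left h0)
    apply hq0
    funext j
    fin_cases j
    · exact_mod_cast h0
    · exact h1
  · refine ⟨-(q 0 / q 1), ?_⟩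
    have h1' : ((q 1 : ℚ) : ℂ) ≠ 0 := by exact_mod_cast h1
    have hw' : ((q 1 : ℚ) : ℂ) • w = -(((q 0 : ℚ) : ℂ) • ρ) := eq_neg_of_add_eq_zero_right hq
    rw [show w = ((q 1 : ℚ) : ℂ)⁻¹ • -(((q 0 : ℚ) : ℂ) • ρ) by rw [← hw', inv_smul_smul₀ h1'],
      ← neg_smul, smul_smul]
    congr 1
    push_cast
    field_simp

/-- With Grothendieck's coniveau inclusion: a class supported in codimension `≥ k`, in degree `2k`, is of
Hodge type `(k,k)` in every Hodge model `A` (`p + q = 2k`, `p, q ≥ k` forces `p = q = k`). -/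
theorem pullback_mem_hodgePQ_of_mem_supportedClasses {n : ℕ}
    (hG : Grothendieck1969_supportedClasses_le_hodgeConiveau) (hX : IsSmoothProjective n X)
    (A : HodgeModel n X) {k : ℕ} {x : complexBetti X (2 * k)} (hx : x ∈ supportedClasses X (2 * k) k) :
    A.pullback (2 * k) x ∈ A.hodgePQ (2 * k) k k := by
  have h : A.hodgeConiveau (2 * k) k ≤ A.hodgePQ (2 * k) k k := by
    refine iSup_le fun p ↦ iSup_le fun q ↦ iSup_le fun hpq ↦ iSup_le fun hp ↦ iSup_le fun hq ↦ ?_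
    obtain rfl : p = k := by omega
    obtain rfl : q = p := by omega
    exact le_rfl
  exact h (hG hX A (2 * k) k (Submodule.mem_map_of_mem hx))

/-- **Non-isotropy of rational Hodge `(n,n)`-classes modulo the Lefschetz classes** (`dim X = 2n`,
`n = m + 1`): a rational class `t` of type `(n,n)` in the model `A` with `t ∪ (b ∪ d) = 0` for every
rational Hodge `(m,m)`-class `b` and divisor class `d ∈ N¹ H²`, and `t ∪ t = 0`, is zero. With the datum
`Λ` of the Kähler package write `t = p + L a`, `p` primitive, `a` rational of type `(m,m)` (Lefschetz
step); for `b ∈ Hdg^{m,m}_ℚ`, `0 = t ∪ L b = (L p) ∪ b + a ∪ L² b = a ∪ L² b`, and every rational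
`(m+2,m+2)`-class is `L² b` (hard Lefschetz over `ℚ`), so `a = 0` by the perfect pairing (6.1)
(`hodgeClasses_cupPairing_nondegenerate_of_hodgeRiemann`); then `t = p` is primitive with `p ∪ p = 0`, so
`p = 0` by the Hodge–Riemann anisotropy. [cite: VoisinHodgeI2002, §6.2.3, Thm. 6.32 and §7.1.2] -/
theorem hodgeClass_eq_zero_of_cup_orthogonal
    (hK : hardLefschetz_hodgeRiemann (2 * (m + 1)) X) (hX : IsSmoothProjective (2 * (m + 1)) X)
    (A : HodgeModel (2 * (m + 1)) X) {t : complexBetti X (2 * (m + 1))} (htQ : IsRationalClass t)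
    (htA : A.pullback (2 * (m + 1)) t ∈ A.hodgePQ (2 * (m + 1)) (m + 1) (m + 1))
    (horth : ∀ b : complexBetti X (2 * m), IsRationalClass b →
      IsOfHodgeType (2 * (m + 1)) X (2 * m) m m b → ∀ d ∈ algebraicClasses X 1,
        cupProduct (two_mul_add_two_mul (m + 1) (m + 1)) t
          (cupProduct (two_mul_add_two_mul m 1) b d) = 0)
    (hself : cupProduct (two_mul_add_two_mul (m + 1) (m + 1)) t t = 0) : t = 0 := by
  have hI : hodgePQ_independent_of_hodgeModel := hodgePQ_independent_of_hodgeModel_holds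
  obtain ⟨Λ, hHR⟩ := hK hX
  set κ := Λ.hyperplaneClass with hκ
  have hkl : 2 + 2 * m = 2 * (m + 1) := by omega
  obtain ⟨p, a, ht, hprim, hQ, hT⟩ := Λ.exists_eq_primitive_add_lefschetzOperator
    (k := 2 * m) (j := 0 + 1) (l := 2 * (m + 1)) (t := 2 * (m + 1) + 2 * (0 + 1))
    (by omega) hkl rfl t
  obtain ⟨hpQ, haQ⟩ := hQ htQ
  obtain ⟨hpA, haA⟩ := hT A m m hI hX htA
  have haT : IsOfHodgeType (2 * (m + 1)) X (2 * m) m m a := ⟨A, haA⟩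
  have hpT : IsOfHodgeType (2 * (m + 1)) X (2 * (m + 1)) (m + 1) (m + 1) p := ⟨A, hpA⟩
  have hLb : ∀ b : complexBetti X (2 * m),
      cupProduct (two_mul_add_two_mul m 1) b κ = lefschetzOperator κ hkl b := by
    intro b
    rw [lefschetzOperator_apply, cupProduct_gradedComm_holds ℂ (ComplexPoints X)
      (two_mul_add_two_mul m 1) hkl b κ, Even.neg_one_pow ⟨m * 2, by ring⟩, one_smul]
  have hkl' : 2 + 2 * (m + 1) = 2 * (m + 1) + 2 * (0 + 1) := by omega
  have hLp : lefschetzOperator κ hkl' p = 0 := by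
    have h := hprim
    simp only [HardLefschetzNFold.L] at h
    rw [lefschetzPowTo_succ_apply κ 0 (2 * (m + 1)) (2 * (m + 1)) (2 * (m + 1) + 2 * (0 + 1)) rfl
      rfl hkl', lefschetzPowTo_zero_apply] at h
    exact h
  have hL1 : ∀ w : complexBetti X (2 * m), lefschetzOperator κ hkl w =
      lefschetzPowTo κ 1 (2 * m) (2 * (m + 1)) (by omega) w := fun w ↦ by
    rw [lefschetzPowTo_succ_apply κ 0 (2 * m) (2 * m) (2 * (m + 1)) rfl (by omega) hkl,
      lefschetzPowTo_zero_apply]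
  have ha0 : a = 0 := by
    by_contra ha0
    have P := Λ.hodgeClasses_cupPairing_nondegenerate_of_hodgeRiemann hI hHR
    obtain ⟨a', ha'Q, ha'T, hne⟩ := P hX (k := m) (l := m + 2) (2 * ((m + 1) + (m + 1))) (by omega)
      (by omega) a haQ haT ha0
    obtain ⟨b, hbQ, hbT, rfl⟩ := Λ.exists_hdg_preimage (j := 2) (k := 2 * m) (by omega)
      (2 * (m + 2)) (by omega) m m a' ha'Q ha'T
    have h0 := horth b hbQ hbT κ Λ.hyperplaneClass_mem
    rw [hLb, ht, map_add, LinearMap.add_apply] at h0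
    rw [cupProduct_lefschetzOperator_right κ hkl (two_mul_add_two_mul (m + 1) (m + 1))
        (rfl : 2 * (m + 1) + 2 * m = 2 * (m + 1) + 2 * m) (by omega),
      ← cupProduct_lefschetzOperator_left κ hkl' (by omega)
        (rfl : 2 * (m + 1) + 2 * m = 2 * (m + 1) + 2 * m) (by omega) p b,
      hLp, map_zero, LinearMap.zero_apply, zero_add] at h0
    rw [hL1, hL1, cupProduct_lefschetzPowTo_lefschetzPowTo κ 1 1 (by omega) (by omega)
        (two_mul_add_two_mul (m + 1) (m + 1)) (by omega : 2 * m + 2 * (1 + 1) = 2 * (m + 2))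
        (by omega) a b,
      lefschetzPowTo_congr_exponent κ (rfl : 1 + 1 = 2) _
        (by omega : 2 * m + 2 * 2 = 2 * (m + 2)) b] at h0
    exact hne h0
  subst ha0
  rw [map_zero, add_zero] at ht
  rw [ht] at hself ⊢
  by_contra hp0
  have H := hHR (m + 1) 0 (by omega) p hpQ hpT hprim hp0
  apply H
  show cupProduct (by omega : 2 * (m + 1) + 2 * (m + 1) = 2 * (2 * (m + 1))) p p = 0
  rw [cupProduct_eq_zero_iff_of_degree_eq _ (two_mul_add_two_mul (m + 1) (m + 1)) p p]
  exact hself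

/-- **The orthogonal split, abstract form.** `X` smooth projective of dimension `2n`, `n = m + 1`, `A` a
Hodge model, `T ⊆ H^{2n}(X(ℂ); ℂ)` a subspace (T1) inside the `ℂ`-span of its rational Hodge
`(n,n)`-classes and (T2) containing `b ∪ d` for all rational Hodge `(m,m)`-classes `b` and divisor classes
`d ∈ N¹ H²`: every rational Hodge `(n,n)`-class `c` lies in `T + span_ℂ {e rational Hodge (n,n) : e ∪ T = 0}`
(finite `ℂ`-basis `tᵢ` of `T` among its rational Hodge classes; `tᵢ ∪ tⱼ`, `c ∪ tⱼ` are rational classes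
of the line `H^{4n}(X(ℂ); ℂ)`; a rational combination of the `tᵢ` orthogonal to `T` vanishes by
`hodgeClass_eq_zero_of_cup_orthogonal` and (T2); then `exists_sub_sum_cup_eq_zero`).
[cite: VoisinHodgeI2002, §6.3.2 Thm. 6.32 and §7.1.2] [cite: BrosnanFangNiePearlstein2009, §6 (6.1)] -/
theorem mem_sup_span_orthogonal
    (hK : hardLefschetz_hodgeRiemann (2 * (m + 1)) X) (hX : IsSmoothProjective (2 * (m + 1)) X)
    (A : HodgeModel (2 * (m + 1)) X) (T : Submodule ℂ (complexBetti X (2 * (m + 1))))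
    (hT1 : T ≤ Submodule.span ℂ {x : complexBetti X (2 * (m + 1)) | x ∈ T ∧ IsRationalClass x ∧
      IsOfHodgeType (2 * (m + 1)) X (2 * (m + 1)) (m + 1) (m + 1) x})
    (hT2 : ∀ b : complexBetti X (2 * m), IsRationalClass b →
      IsOfHodgeType (2 * (m + 1)) X (2 * m) m m b → ∀ d ∈ algebraicClasses X 1,
        cupProduct (two_mul_add_two_mul m 1) b d ∈ T)
    {c : complexBetti X (2 * (m + 1))} (hcQ : IsRationalClass c)
    (hcA : A.pullback (2 * (m + 1)) c ∈ A.hodgePQ (2 * (m + 1)) (m + 1) (m + 1)) :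
    c ∈ T ⊔ Submodule.span ℂ {e : complexBetti X (2 * (m + 1)) | IsRationalClass e ∧
      IsOfHodgeType (2 * (m + 1)) X (2 * (m + 1)) (m + 1) (m + 1) e ∧
      ∀ x ∈ T, cupProduct (two_mul_add_two_mul (m + 1) (m + 1)) e x = 0} := by
  have hI : hodgePQ_independent_of_hodgeModel := hodgePQ_independent_of_hodgeModel_holds
  haveI := finite_complexBetti hX (2 * (m + 1))
  set B : complexBetti X (2 * (m + 1)) →ₗ[ℂ] complexBetti X (2 * (m + 1)) →ₗ[ℂ]
      complexBetti X (2 * ((m + 1) + (m + 1))) := cupProduct (two_mul_add_two_mul (m + 1) (m + 1))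
  set S : Set (complexBetti X (2 * (m + 1))) := {x | x ∈ T ∧ IsRationalClass x ∧
      IsOfHodgeType (2 * (m + 1)) X (2 * (m + 1)) (m + 1) (m + 1) x}
  have hTS : T = Submodule.span ℂ S := le_antisymm hT1 (Submodule.span_le.2 fun x hx ↦ hx.1)
  obtain ⟨b, hbS, hbspan, hli⟩ := exists_linearIndependent ℂ S
  have hbfin : b.Finite := hli.set_finite_of_isNoetherian
  haveI : Fintype b := hbfin.fintype
  have hTb : T = Submodule.span ℂ b := by rw [hTS, hbspan]
  have hbT : ∀ i : b, (i : complexBetti X (2 * (m + 1))) ∈ T := fun i ↦ (hbS i.2).1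
  have hbQ : ∀ i : b, IsRationalClass (i : complexBetti X (2 * (m + 1))) := fun i ↦ (hbS i.2).2.1
  have hbA : ∀ i : b, A.pullback (2 * (m + 1)) (i : complexBetti X (2 * (m + 1))) ∈
      A.hodgePQ (2 * (m + 1)) (m + 1) (m + 1) :=
    fun i ↦ (hI.isOfHodgeType_iff hX A).1 (hbS i.2).2.2
  have htop : Module.finrank ℂ (complexBetti X (2 * ((m + 1) + (m + 1)))) = 1 := by
    rw [show 2 * ((m + 1) + (m + 1)) = 2 * (2 * (m + 1)) by ring]
    exact finrank_complexBetti_two_mul_eq_one hX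
  obtain ⟨ρ, hρQ, hρ0⟩ : ∃ ρ : complexBetti X (2 * ((m + 1) + (m + 1))), IsRationalClass ρ ∧ ρ ≠ 0 := by
    by_contra h
    push Not at h
    have hbot : Submodule.span ℂ {x : complexBetti X (2 * ((m + 1) + (m + 1))) | IsRationalClass x} = ⊥ :=
      Submodule.span_eq_bot.2 h
    have htop' := span_isRationalClass_eq_top_of_isSmoothProjective_holds _ X hX (2 * ((m + 1) + (m + 1)))
    rw [hbot] at htop'
    haveI : Nontrivial (complexBetti X (2 * ((m + 1) + (m + 1)))) :=
      Module.nontrivial_of_finrank_eq_succ htop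
    exact bot_ne_top htop'
  have hline : ∀ w : complexBetti X (2 * ((m + 1) + (m + 1))), IsRationalClass w →
      ∃ q : ℚ, w = ((q : ℚ) : ℂ) • ρ :=
    fun w hw ↦ exists_eq_ratCast_smul_of_isRationalClass htop hρQ hρ0 hw
  choose g hg using fun i j : b ↦
    hline _ ((hbQ i).cup (two_mul_add_two_mul (m + 1) (m + 1)) (hbQ j))
  choose γ hγ using fun j : b ↦ hline _ (hcQ.cup (two_mul_add_two_mul (m + 1) (m + 1)) (hbQ j))
  have horthT : ∀ e : complexBetti X (2 * (m + 1)),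
      (∀ j : b, B e (j : complexBetti X (2 * (m + 1))) = 0) → ∀ x ∈ T, B e x = 0 := by
    intro e he x hx
    rw [hTb] at hx
    exact LinearMap.mem_ker.1 ((Submodule.span_le (p := LinearMap.ker (B e))).2
      (fun y hy ↦ LinearMap.mem_ker.2 (he ⟨y, hy⟩)) hx)
  have hsumT : ∀ q : b → ℚ, (∑ i, ((q i : ℚ) : ℂ) • (i : complexBetti X (2 * (m + 1)))) ∈ T :=
    fun q ↦ Submodule.sum_mem _ fun i _ ↦ Submodule.smul_mem _ _ (hbT i)
  have hsumQ : ∀ q : b → ℚ, IsRationalClass (∑ i, ((q i : ℚ) : ℂ) • (i : complexBetti X (2 * (m + 1)))) :=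
    fun q ↦ IsRationalClass.sum_smul Finset.univ (fun i ↦ hbQ i) q
  have hsumA : ∀ q : b → ℚ, A.pullback (2 * (m + 1)) (∑ i, ((q i : ℚ) : ℂ) • (i : complexBetti X (2 * (m + 1))))
      ∈ A.hodgePQ (2 * (m + 1)) (m + 1) (m + 1) := fun q ↦ by
    rw [map_sum]
    exact Submodule.sum_mem _ fun i _ ↦ by rw [map_smul]; exact Submodule.smul_mem _ _ (hbA i)
  have hN : ∀ q : b → ℚ,
      (∀ j : b, B (∑ i, ((q i : ℚ) : ℂ) • (i : complexBetti X (2 * (m + 1))))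
        (j : complexBetti X (2 * (m + 1))) = 0) → q = 0 := by
    intro q hq
    have hvan := horthT _ hq
    have h0 := hodgeClass_eq_zero_of_cup_orthogonal hK hX A (hsumQ q) (hsumA q)
      (fun b' hb'Q hb'T d hd ↦ hvan _ (hT2 b' hb'Q hb'T d hd)) (hvan _ (hsumT q))
    have hli' : LinearIndependent ℂ (fun i : b ↦ (i : complexBetti X (2 * (m + 1)))) := hli
    funext i
    have := Fintype.linearIndependent_iff.1 hli' (fun i ↦ ((q i : ℚ) : ℂ)) h0 i
    show q i = 0
    exact_mod_cast this
  obtain ⟨q, hq⟩ := exists_sub_sum_cup_eq_zero B (fun i : b ↦ (i : complexBetti X (2 * (m + 1))))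
    c g hg γ hγ hN
  rw [show c = (∑ i, ((q i : ℚ) : ℂ) • ((i : b) : complexBetti X (2 * (m + 1)))) +
      (c - ∑ i, ((q i : ℚ) : ℂ) • ((i : b) : complexBetti X (2 * (m + 1)))) by abel]
  refine Submodule.add_mem_sup (hsumT q) (Submodule.subset_span ⟨?_, ⟨A, ?_⟩, horthT _ hq⟩)
  · simpa [sub_eq_add_neg] using hcQ.add ((hsumQ q).smul (-1))
  · rw [map_sub]
    exact Submodule.sub_mem _ hcA (hsumA q)

/-- **`OrthogonalSplit` from the Kähler package** (route `EndoscopicMiddleDegree`, item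
stmt-HodgeConjecture-14299), CONDITIONAL on `Grothendieck1969_supportedClasses_le_hodgeConiveau`,
`exists_deRhamIsoFamily` and `hardLefschetz_hodgeRiemann`: `mem_sup_span_orthogonal` for `T = TW(D)` —
(T1): classes supported on a Zariski-closed set are spanned by the RATIONAL classes supported there
(`ker_restrictCompl_le_span`), of type `(codim, codim)` in degree `2 · codim` (Grothendieck's coniveau
inclusion); divisor classes are spanned by rational `(1,1)` divisor classes and `(m,m) ∪ (1,1) = (m+1,m+1)`
(cup product bigraded by de Rham's theorem in the model `A`); (T2): the third summand.
[cite: VoisinHodgeI2002, Thm. 6.25, Thm. 6.32 and §7.1.2] [cite: GrothendieckTopology1969, p. 299 (∗) and p. 300] -/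
theorem orthogonalSplit_of_kaehlerPackage
    (hG : Grothendieck1969_supportedClasses_le_hodgeConiveau)
    (hdR : ∀ (E : Type) [NormedAddCommGroup E] [NormedSpace ℂ E] [FiniteDimensional ℂ E],
      Literature.NumberTheory.Transcendental.exists_deRhamIsoFamily 𝓘(ℝ, E))
    (hK : ∀ (n : ℕ) (Y : SchemeOver ℂ), hardLefschetz_hodgeRiemann n Y) :
    Theses.EndoscopicMiddleDegree.OrthogonalSplit := by
  unfold Theses.EndoscopicMiddleDegree.OrthogonalSplit
  intro m X D _ _ c hcQ hcT
  have hX : IsSmoothProjective (2 * (m + 1)) X := D.isSmoothProjective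
  obtain ⟨A, hcA⟩ := hcT
  have hcup : CupPreservesHodgeType (2 * (m + 1)) X :=
    cupPreservesHodgeType_of_exists_deRhamIsoFamily hodgePQ_independent_of_hodgeModel_holds hX A
      (hdR A.model)
  refine mem_sup_span_orthogonal (hK _ X) hX A _ ?_ ?_ hcQ hcA
  · refine sup_le (sup_le ?_ ?_) ?_
    · refine iSup_le fun W ↦ iSup_le fun hW ↦ iSup_le fun hk ↦ ?_
      intro x hx
      have hcodim : ∀ z ∈ D.specialSubvariety W, ((m + 1 : ℕ) : ℕ∞) ≤ Order.coheight z := by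
        intro z hz
        have := D.le_coheight_of_mem_specialSubvariety W hW z hz
        rw [hk] at this
        exact_mod_cast this
      refine Submodule.span_mono ?_
        (span_isRationalClass_eq_top_of_isSmoothProjective.ker_restrictCompl_le_span
          span_isRationalClass_eq_top_of_isSmoothProjective_holds hX (D.specialSubvariety W)
          (2 * (m + 1)) hx)
      rintro y ⟨hyQ, hy0⟩
      have hy : y ∈ classesSupportedOn X (D.specialSubvariety W) (2 * (m + 1)) :=
        mem_classesSupportedOn_iff.2 hy0
      refine ⟨?_, hyQ, ⟨A, pullback_mem_hodgePQ_of_mem_supportedClasses hG hX A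
        (classesSupportedOn_le_supportedClasses (D.isClosed_specialSubvariety W hW) hcodim _ hy)⟩⟩
      exact Submodule.mem_sup_left (Submodule.mem_sup_left
        (Submodule.mem_iSup_of_mem W (Submodule.mem_iSup_of_mem hW (Submodule.mem_iSup_of_mem hk hy))))
    · refine iSup_le fun W ↦ iSup_le fun hW ↦ iSup_le fun hk ↦ iSup_le fun Z ↦ iSup_le fun hZ ↦
        iSup_le fun hZW ↦ iSup_le fun hcodim ↦ ?_
      intro x hx
      refine Submodule.span_mono ?_
        (span_isRationalClass_eq_top_of_isSmoothProjective.ker_restrictCompl_le_span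
          span_isRationalClass_eq_top_of_isSmoothProjective_holds hX Z (2 * (m + 1)) hx)
      rintro y ⟨hyQ, hy0⟩
      have hy : y ∈ classesSupportedOn X Z (2 * (m + 1)) := mem_classesSupportedOn_iff.2 hy0
      refine ⟨?_, hyQ, ⟨A, pullback_mem_hodgePQ_of_mem_supportedClasses hG hX A
        (classesSupportedOn_le_supportedClasses hZ hcodim _ hy)⟩⟩
      exact Submodule.mem_sup_left (Submodule.mem_sup_right
        (Submodule.mem_iSup_of_mem W (Submodule.mem_iSup_of_mem hW (Submodule.mem_iSup_of_mem hk
          (Submodule.mem_iSup_of_mem Z (Submodule.mem_iSup_of_mem hZ (Submodule.mem_iSup_of_mem hZW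
            (Submodule.mem_iSup_of_mem hcodim hy))))))))
    · refine Submodule.span_le.2 ?_
      rintro z ⟨a, haQ, haT, d, hd, rfl⟩
      have hd' := supportedClasses_le_span_isRationalClass hX (2 * 1) 1 hd
      have hz := Submodule.mem_map_of_mem (f := cupProduct (two_mul_add_two_mul m 1) a) hd'
      rw [Submodule.map_span] at hz
      refine Submodule.span_mono ?_ hz
      rintro _ ⟨d', ⟨hd'Q, hd'N⟩, rfl⟩
      refine ⟨?_, haQ.cup _ hd'Q, ?_⟩
      · exact Submodule.mem_sup_right (Submodule.subset_span ⟨a, haQ, haT, d', hd'N, rfl⟩)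
      · exact hcup (two_mul_add_two_mul m 1) haT
          ⟨A, pullback_mem_hodgePQ_of_mem_supportedClasses hG hX A hd'N⟩
  · intro b hbQ hbT d hd
    exact Submodule.mem_sup_right (Submodule.subset_span ⟨b, hbQ, hbT, d, hd, rfl⟩)

end Summit.HodgeConjecture.HodgeConjecture.Theorems

end
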